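import Mathlib
import Summits.KontsevichZagierPeriods.KontsevichZagierPeriods.Theses.InverseLandau
import Literature.NumberTheory.Transcendental.KZCalculus
import Literature.NumberTheory.Transcendental.KZLogCalculusProofs
import Literature.NumberTheory.Transcendental.KZProductIdeal
import Literature.NumberTheory.Transcendental.KZBetaChains
import Summits.KontsevichZagierPeriods.KontsevichZagierPeriods.Theorems.CobordismMoveCP2VolumeCharts
import Summits.KontsevichZagierPeriods.KontsevichZagierPeriods.Theorems.InverseLandauTateLiftingLowDimAlgSector
import Summits.KontsevichZagierPeriods.KontsevichZagierPeriods.Theorems.InverseLandauTateLiftingTubeIsTwist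
import Summits.KontsevichZagierPeriods.KontsevichZagierPeriods.Theorems.InverseLandauTateLiftingPolydiscPow

/-!
# `TateLifting` (stmt-KontsevichZagierPeriods-9129), line `Sketch` — squares of rational angles

Stub `stub_rationalAngleSquares` of the crux `TateLifting` (kernel form of the Kontsevich–Zagier
period conjecture), verbatim the item `RationalAngleSquares` (stmt-KontsevichZagierPeriods-3820) of
route SphericalSchlafli: for `0 < m < n` and `T = tan(mπ/2n)`, every representation
`a = [[0,T]², 4/((1+x²)(1+y²))]` (value `(2 arctan T)² = (mπ/n)²`) and every integrand-`1`
representation `p` over the bidisc `D̄ × D̄ ⊆ ℝ⁴` (value `π²`) satisfy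
`n² • [a] − m² • [p] ∈ KZ.relations`.

## Proof (`tateLifting_rationalAngleSquares`)

Everything happens in the (commutative) formal period ring `P = FormalRep ⧸ relations` of
`Literature/NumberTheory/Transcendental/KZRulesAssociator.lean` (`KZ.toFormalPeriod`,
`KZ.toFormalPeriod_eq_zero_iff`, `KZ.toFormalPeriod_of_mul_of`):

* the square is a product: `a` has the domain and (on it) the integrand of `A.prod A`,
  `A = [[0,T], 2/(1+x²)]` (`exists_arcRep`; the interval `[0,T]` is `ℚ`-semialgebraic as the
  preimage of `a.domain` under the polynomial map `x ↦ (x, 0)`, so no algebraicity of `T` is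
  needed), hence `⟦a⟧ = ⟦A⟧²` (`square_equivalent_prod`, rule (1));
* the bidisc has the class `⟦π⟧²`, `⟦π⟧ = ⟦KZ.piRep⟧` (the landed `tateLifting_polydiscPow`,
  `k = 2`);
* `value A = 2 arctan T = mπ/n` (`arcRep_value`, `Real.arctan_tan`) and the Cauchy representation
  `L = [ℝ, 1/(1+t²)]` has `L ∼ KZ.piRep` (the landed `TubeIsTwist.cauchy_equivalent_piRep`), value
  `π`; so the dimension-one combination `u = n • [A] − m • [L]` of KZ-rational representations
  evaluates to `n·(mπ/n) − m·π = 0` and is a relation by THE DIMENSION-ONE RATIONAL KERNEL THEOREM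
  `kzKernelConjecture_lowDimAlg` (Theorems/InverseLandauTateLiftingLowDimAlgSector.lean, resting on
  Baker's theorem) — `nsmul_of_sub_nsmul_of_mem_relations`;
* in `P`: `n ⟦A⟧ = m ⟦π⟧`, hence `n² ⟦a⟧ − m² ⟦p⟧ = (n⟦A⟧)² − (m⟦π⟧)² = 0`.

References: M. Kontsevich, D. Zagier, *Periods* (2001), §1.1 eq. (1), §1.2, §4.1; A. Baker,
*Transcendental Number Theory* (1975), Thm 2.1.
-/

noncomputable section

namespace Summit.KontsevichZagierPeriods.InverseLandau

open MeasureTheory Set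
open Literature.NumberTheory.Transcendental

namespace RationalAngleSquares

/-! ## The arc representation `A = [[0,T], 2/(1+x²)]` -/

/-- The interval `{x ∈ ℝ¹ | 0 ≤ x₀ ≤ T}` is `ℚ`-semialgebraic as soon as the square
`{0 ≤ x₀ ≤ T, 0 ≤ x₁ ≤ T}` is and `0 ≤ T`: it is the preimage of the square under the polynomial
map `x ↦ (x₀, 0)` (no algebraicity of `T` needed). [cite: BCR1998, §2.1] -/
theorem isSemialgebraic_interval_of_square (T : ℝ) (hT : 0 ≤ T) (a : KZ.IntegralRep 2)
    (ha : a.domain = {x | 0 ≤ x 0 ∧ x 0 ≤ T ∧ 0 ≤ x 1 ∧ x 1 ≤ T}) :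
    Literature.ModelTheory.ExponentialFields.IsSemialgebraic ℚ
      {x : Fin 1 → ℝ | 0 ≤ x 0 ∧ x 0 ≤ T} := by
  have h := a.isSemialgebraic_domain.preimage_aeval
    (![MvPolynomial.X 0, 0] : Fin 2 → MvPolynomial (Fin 1) ℚ)
  rw [ha] at h
  convert h using 1
  ext x
  simp only [mem_setOf_eq, mem_preimage, Matrix.cons_val_zero, Matrix.cons_val_one,
    MvPolynomial.aeval_X, map_zero, le_refl, hT, and_true]

/-- **The arc representation exists**: for `0 ≤ T` with `ℚ`-semialgebraic square `[0,T]²` there is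
a dimension-one representation `A = [[0,T], 2/(1+x²)]` (integrand a quotient of `ℚ`-polynomials
with non-vanishing denominator; integrable since `2/(1+t²)` is integrable on `ℝ`).
[cite: KontsevichZagier2001, §1.1] -/
theorem exists_arcRep (T : ℝ) (hT : 0 ≤ T) (a : KZ.IntegralRep 2)
    (ha : a.domain = {x | 0 ≤ x 0 ∧ x 0 ≤ T ∧ 0 ≤ x 1 ∧ x 1 ≤ T}) :
    ∃ A : KZ.IntegralRep 1, A.domain = {x | 0 ≤ x 0 ∧ x 0 ≤ T} ∧
      A.integrand = fun x => 2 / (1 + x 0 ^ 2) := by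
  have hJ := isSemialgebraic_interval_of_square T hT a ha
  have hsa : IsSemialgebraicFunOn ℚ {x : Fin 1 → ℝ | 0 ≤ x 0 ∧ x 0 ≤ T}
      (fun x => 2 / (1 + x 0 ^ 2)) := by
    refine (isSemialgebraicFunOn_aeval_div_aeval hJ (2 : MvPolynomial (Fin 1) ℚ)
      (1 + MvPolynomial.X 0 ^ 2) fun y _ => ?_).congr fun y _ => ?_
    · have hy : (0 : ℝ) < 1 + y 0 ^ 2 := by positivity
      simpa using hy.ne'
    · simp
  have hint : IntegrableOn (fun x : Fin 1 → ℝ => 2 / (1 + x 0 ^ 2))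
      {x : Fin 1 → ℝ | 0 ≤ x 0 ∧ x 0 ≤ T} := by
    have h := (KZ.integrableOn_setOf_apply_mem_iff (g := fun t : ℝ => 2 / (1 + t ^ 2))
      (S := Icc 0 T)).2 ((integrable_inv_one_add_sq.const_mul 2).integrableOn.congr_fun
        (fun t _ => by rw [div_eq_mul_inv]) measurableSet_Icc)
    exact h
  exact ⟨⟨_, _, hJ, hsa, hint⟩, rfl, rfl⟩

/-- Transport of set integrals between `S ⊆ ℝ` and `{x | x 0 ∈ S} ⊆ ℝ¹`. [folklore] -/
theorem setIntegral_setOf_apply_mem (g : ℝ → ℝ) (S : Set ℝ) :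
    ∫ x in {x : Fin 1 → ℝ | x 0 ∈ S}, g (x 0) = ∫ t in S, g t := by
  rw [← (volume_preserving_funUnique (Fin 1) ℝ).setIntegral_preimage_emb
    (MeasurableEquiv.funUnique (Fin 1) ℝ).measurableEmbedding g S]
  rfl

/-- **`value [[0,T], 2/(1+x²)] = 2 arctan T`** (`0 ≤ T`): the fundamental theorem of calculus for
`arctan` (`integral_inv_one_add_sq`). [folklore] -/
theorem arcRep_value (T : ℝ) (hT : 0 ≤ T) (A : KZ.IntegralRep 1)
    (hAd : A.domain = {x | 0 ≤ x 0 ∧ x 0 ≤ T}) (hAi : A.integrand = fun x => 2 / (1 + x 0 ^ 2)) :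
    A.value = 2 * Real.arctan T := by
  rw [KZ.IntegralRep.value, hAd, hAi]
  have h1 : ∫ x in {x : Fin 1 → ℝ | 0 ≤ x 0 ∧ x 0 ≤ T}, 2 / (1 + x 0 ^ 2) =
      ∫ t in Icc 0 T, 2 / (1 + t ^ 2) :=
    setIntegral_setOf_apply_mem (fun t => 2 / (1 + t ^ 2)) (Icc 0 T)
  have h2 : (fun t : ℝ => 2 / (1 + t ^ 2)) = fun t => 2 * (1 + t ^ 2)⁻¹ := by
    funext t
    rw [div_eq_mul_inv]
  rw [h1, integral_Icc_eq_integral_Ioc, ← intervalIntegral.integral_of_le hT, h2,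
    intervalIntegral.integral_const_mul, integral_inv_one_add_sq, Real.arctan_zero, sub_zero]

/-! ## The square is the product `A × A`, the bidisc is `⟦π⟧²` -/

/-- The leading block coordinate of `ℝ¹ × ℝ¹ = ℝ²` is the coordinate `0`. [folklore] -/
theorem castAdd_one_zero : Fin.castAdd 1 (0 : Fin 1) = (0 : Fin 2) := rfl

/-- The trailing block coordinate of `ℝ¹ × ℝ¹ = ℝ²` is the coordinate `1`. [folklore] -/
theorem natAdd_one_zero : Fin.natAdd 1 (0 : Fin 1) = (1 : Fin 2) := rfl

/-- **The square is a product** (rule (1)): `a = [[0,T]², 4/((1+x²)(1+y²))]` has the domain of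
`A.prod A` and, on it, its integrand `(2/(1+x²))·(2/(1+y²))`, hence `a ∼ A.prod A`
(`KZ.of_sub_of_mem_relations_of_eqOn`). [cite: KontsevichZagier2001, §1.2] -/
theorem square_equivalent_prod (T : ℝ) (a : KZ.IntegralRep 2)
    (ha : a.domain = {x | 0 ≤ x 0 ∧ x 0 ≤ T ∧ 0 ≤ x 1 ∧ x 1 ≤ T})
    (hai : ∀ x ∈ a.domain, a.integrand x = 4 / ((1 + x 0 ^ 2) * (1 + x 1 ^ 2)))
    (A : KZ.IntegralRep 1) (hAd : A.domain = {x | 0 ≤ x 0 ∧ x 0 ≤ T})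
    (hAi : A.integrand = fun x => 2 / (1 + x 0 ^ 2)) : KZ.Equivalent a (A.prod A) := by
  refine KZ.of_sub_of_mem_relations_of_eqOn ?_ fun z hz => ?_
  · rw [KZ.IntegralRep.prod_domain, ha]
    ext z
    simp only [KZ.IntegralRep.mem_prodDomain, hAd, mem_setOf_eq, castAdd_one_zero,
      natAdd_one_zero, and_assoc]
  · rw [hai z hz, KZ.IntegralRep.prod_integrand_eq, KZ.IntegralRep.prodFun_apply, hAi]
    simp only [castAdd_one_zero, natAdd_one_zero]
    have h0 : (0 : ℝ) < 1 + z 0 ^ 2 := by positivity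
    have h1 : (0 : ℝ) < 1 + z 1 ^ 2 := by positivity
    field_simp
    norm_num

/-- **The bidisc has the class `⟦π⟧²`**: an integrand-`1` representation over
`{v | v₀² + v₁² ≤ 1 ∧ v₂² + v₃² ≤ 1} ⊆ ℝ⁴` is the case `k = 2` of the landed polydisc theorem
`tateLifting_polydiscPow`. [cite: KontsevichZagier2001, §4.1] -/
theorem toFormalPeriod_bidisc (p : KZ.IntegralRep 4)
    (hp : p.domain = {v | v 0 ^ 2 + v 1 ^ 2 ≤ 1 ∧ v 2 ^ 2 + v 3 ^ 2 ≤ 1})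
    (hpi : ∀ v ∈ p.domain, p.integrand v = 1) :
    KZ.toFormalPeriod (KZ.of p) = KZ.toFormalPeriod (KZ.of KZ.piRep) ^ 2 := by
  refine tateLifting_polydiscPow 2 p ?_ hpi
  rw [hp]
  ext v
  simp only [mem_setOf_eq, Fin.forall_fin_two]
  exact Iff.rfl

/-! ## The dimension-one kernel: `n • [A] − m • [L]` is a relation -/

/-- A dimension-one representation with integrand `c/(1+x²)` on its domain (`c ∈ ℚ`) has KZ's
literal rational shape. [cite: KontsevichZagier2001, §1.1] -/
theorem isRational_of_const_div (r : KZ.IntegralRep 1) (c : ℚ)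
    (hr : ∀ x ∈ r.domain, r.integrand x = c / (1 + x 0 ^ 2)) : r.IsRational := by
  refine ⟨MvPolynomial.C c, 1 + MvPolynomial.X 0 ^ 2, fun x _ => ?_, fun x hx => ?_⟩
  · have hx : (0 : ℝ) < 1 + x 0 ^ 2 := by positivity
    simpa using hx.ne'
  · rw [hr x hx]
    simp

/-- A KZ-rational representation of dimension one is one of the generators of the subgroup on
which `kzKernelConjecture_lowDimAlg` is stated (read with algebraic coefficients,
`DimOne.las_exists_algReading_of_isRational`). [folklore] -/
theorem of_mem_generators (r : KZ.IntegralRep 1) (hr : r.IsRational) :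
    KZ.of r ∈ {d : KZ.FormalRep | (∃ r : KZ.IntegralRep 0, d = KZ.of r) ∨
      ∃ (r : KZ.IntegralRep 1) (p q : Polynomial ℝ), (∀ i, IsAlgebraic ℚ (p.coeff i)) ∧
        (∀ i, IsAlgebraic ℚ (q.coeff i)) ∧ (∀ x ∈ r.domain, q.eval (x 0) ≠ 0) ∧
        Set.EqOn r.integrand (fun x => p.eval (x 0) / q.eval (x 0)) r.domain ∧ d = KZ.of r} := by
  obtain ⟨p, q, hp, hq, hq0, hpq⟩ := DimOne.las_exists_algReading_of_isRational r hr
  exact Or.inr ⟨r, p, q, hp, hq, hq0, hpq, rfl⟩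

/-- **Commensurable KZ-rational representations of dimension one**: if `A`, `L` are KZ-rational of
dimension one and `c · value A = d · value L` (`c, d ∈ ℕ`), then `c • [A] − d • [L]` is a relation
— the dimension-one rational kernel theorem `kzKernelConjecture_lowDimAlg` (Baker) applied to a
combination with vanishing evaluation. [cite: Baker1975, Thm 2.1] -/
theorem nsmul_of_sub_nsmul_of_mem_relations (c d : ℕ) (A L : KZ.IntegralRep 1)
    (hA : A.IsRational) (hL : L.IsRational) (hv : (c : ℝ) * A.value = d * L.value) :
    c • KZ.of A - d • KZ.of L ∈ KZ.relations := by
  refine kzKernelConjecture_lowDimAlg _ ?_ ?_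
  · exact sub_mem
      (AddSubgroup.nsmul_mem _ (AddSubgroup.subset_closure (of_mem_generators A hA)) c)
      (AddSubgroup.nsmul_mem _ (AddSubgroup.subset_closure (of_mem_generators L hL)) d)
  · rw [map_sub, map_nsmul, map_nsmul, KZ.eval_of, KZ.eval_of, nsmul_eq_mul, nsmul_eq_mul, hv,
      sub_self]

/-- **The angle is rational**: for `0 < m < n`, `θ = mπ/(2n)` lies in `(0, π/2)`, so
`T = tan θ ≥ 0` and `2 arctan T = mπ/n`. [folklore] -/
theorem two_mul_arctan_tan (m n : ℕ) (hm : 0 < m) (hmn : m < n) :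
    0 ≤ Real.tan (m * Real.pi / (2 * n)) ∧
      2 * Real.arctan (Real.tan (m * Real.pi / (2 * n))) = m * Real.pi / n := by
  have hn : (0 : ℝ) < n := by exact_mod_cast hm.trans hmn
  have hm' : (0 : ℝ) < m := by exact_mod_cast hm
  have hlt : (m : ℝ) < n := by exact_mod_cast hmn
  have h1 : 0 < m * Real.pi / (2 * n) := by positivity
  have h2 : m * Real.pi / (2 * n) < Real.pi / 2 := by
    rw [div_lt_div_iff₀ (by positivity) two_pos]
    nlinarith [Real.pi_pos]
  refine ⟨(Real.tan_pos_of_pos_of_lt_pi_div_two h1 h2).le, ?_⟩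
  rw [Real.arctan_tan (by linarith) h2]
  field_simp

end RationalAngleSquares

open RationalAngleSquares in
/-- **Squares of rational angles** (item `RationalAngleSquares`, stmt-KontsevichZagierPeriods-3820,
route SphericalSchlafli; stub `stub_rationalAngleSquares` of line `Sketch` of crux `TateLifting`):
for `0 < m < n`, `T = tan(mπ/2n)`, every `a = [[0,T]², 4/((1+x²)(1+y²))]` and every integrand-`1`
representation `p` of the bidisc `D̄ × D̄ ⊆ ℝ⁴` satisfy `n² • [a] − m² • [p] ∈ KZ.relations`.
In the formal period ring: `⟦a⟧ = ⟦A⟧²` (`A = [[0,T], 2/(1+x²)]`, rule (1) against `A.prod A`),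
`⟦p⟧ = ⟦π⟧²` (`tateLifting_polydiscPow`), and `n⟦A⟧ = m⟦π⟧` because `n • [A] − m • [ℝ, 1/(1+t²)]`
is a vanishing combination of KZ-rational dimension-one representations
(`kzKernelConjecture_lowDimAlg`, values `2 arctan T = mπ/n` and `π`) and `[ℝ, 1/(1+t²)] ∼ [D̄]`
(`TubeIsTwist.cauchy_equivalent_piRep`); then `n²⟦A⟧² − m²⟦π⟧² = (n⟦A⟧)² − (m⟦π⟧)² = 0`.
[cite: KontsevichZagier2001, §1.2] -/
theorem tateLifting_rationalAngleSquares :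
    ∀ (m n : ℕ), 0 < m → m < n → ∀ (a : KZ.IntegralRep 2), a.domain = {x | 0 ≤ x 0 ∧ x 0 ≤ Real.tan (m * Real.pi / (2 * n)) ∧ 0 ≤ x 1 ∧ x 1 ≤ Real.tan (m * Real.pi / (2 * n))} → (∀ x ∈ a.domain, a.integrand x = 4 / ((1 + x 0 ^ 2) * (1 + x 1 ^ 2))) → ∀ (p : KZ.IntegralRep 4), p.domain = {v | v 0 ^ 2 + v 1 ^ 2 ≤ 1 ∧ v 2 ^ 2 + v 3 ^ 2 ≤ 1} → (∀ v ∈ p.domain, p.integrand v = 1) → (n ^ 2) • KZ.of a - (m ^ 2) • KZ.of p ∈ KZ.relations := by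
  intro m n hm hmn a ha hai p hp hpi
  obtain ⟨hT, hθ⟩ := two_mul_arctan_tan m n hm hmn
  have hn : (n : ℝ) ≠ 0 := by
    have h : 0 < n := hm.trans hmn
    exact_mod_cast h.ne'
  -- the arc representation `A = [[0,T], 2/(1+x²)]`, the Cauchy representation `L = [ℝ, 1/(1+t²)]`
  obtain ⟨A, hAd, hAi⟩ := exists_arcRep _ hT a ha
  obtain ⟨L, hLd, hLi⟩ := Summit.KontsevichZagierPeriods.CobordismMove.CP2Volume.exists_cauchyRep₁
  have hL : KZ.Equivalent L KZ.piRep := TubeIsTwist.cauchy_equivalent_piRep L hLd hLi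
  -- values: `value A = mπ/n`, `value L = π`
  have hAv : A.value = m * Real.pi / n := by rw [arcRep_value _ hT A hAd hAi, hθ]
  have hLv : L.value = Real.pi := (KZ.Equivalent.value_eq_holds hL).trans KZ.piRep_value
  -- the dimension-one kernel: `n • [A] − m • [L] ∈ relations`
  have hu : n • KZ.of A - m • KZ.of L ∈ KZ.relations := by
    refine nsmul_of_sub_nsmul_of_mem_relations n m A L
      (isRational_of_const_div A 2 fun x _ => by rw [hAi]; norm_num)
      (isRational_of_const_div L 1 fun x _ => by rw [hLi]; norm_num) ?_
    rw [hAv, hLv]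
    field_simp
  -- pass to the formal period ring
  have ha' : KZ.toFormalPeriod (KZ.of a) =
      KZ.toFormalPeriod (KZ.of A) * KZ.toFormalPeriod (KZ.of A) := by
    rw [(square_equivalent_prod _ a ha hai A hAd hAi).toFormalPeriod_eq,
      KZ.toFormalPeriod_of_mul_of]
  have hp' := toFormalPeriod_bidisc p hp hpi
  have hu' : (n : KZ.FormalPeriodRing) * KZ.toFormalPeriod (KZ.of A) -
      m * KZ.toFormalPeriod (KZ.of KZ.piRep) = 0 := by
    have h := KZ.toFormalPeriod_eq_zero_of_mem hu
    rwa [map_sub, map_nsmul, map_nsmul, hL.toFormalPeriod_eq, nsmul_eq_mul, nsmul_eq_mul] at h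
  rw [← KZ.toFormalPeriod_eq_zero_iff, map_sub, map_nsmul, map_nsmul, ha', hp', nsmul_eq_mul,
    nsmul_eq_mul, Nat.cast_pow, Nat.cast_pow]
  linear_combination ((n : KZ.FormalPeriodRing) * KZ.toFormalPeriod (KZ.of A) +
    m * KZ.toFormalPeriod (KZ.of KZ.piRep)) * hu'

end Summit.KontsevichZagierPeriods.InverseLandau

end
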